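import Summits.BirchSwinnertonDyer.BirchSwinnertonDyer.Theorems.SignedLowerHalvesSmallImageLowerHalfBothSignsLambdaLowerThreeNsThetaPartnerSansLevel
import Summits.BirchSwinnertonDyer.BirchSwinnertonDyer.Theorems.SignedLowerHalvesSmallImageLowerHalfBothSignsLambdaLowerThreeNsThetaPartnerLevelMatchMaxTwo
import Summits.BirchSwinnertonDyer.BirchSwinnertonDyer.Theorems.SignedLowerHalvesSmallImageLowerHalfBothSignsLambdaLowerThreeNsThetaPartnerLevelMatchResidual
import Summits.BirchSwinnertonDyer.BirchSwinnertonDyer.Theorems.SignedLowerHalvesSmallImageLowerHalfBothSignsLambdaLowerThreeNsThetaPartnerLevelMatchWildTorsion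
import Summits.BirchSwinnertonDyer.BirchSwinnertonDyer.Theorems.SignedLowerHalvesSmallImageLowerHalfBothSignsLambdaLowerThreeNsThetaPartnerLevelMatchTateSide
import Literature.NumberTheory.EllipticCurves.GreenbergSelmerOrdinaryFiltrationProofs
import Literature.NumberTheory.EllipticCurves.NewformGaloisRepModLOfPadicAlgClProofs
import Literature.NumberTheory.EllipticCurves.OrdinaryNewformDatumExistsProofs
import Literature.NumberTheory.EllipticCurves.NewformGaloisRepArtinConductor
import Literature.NumberTheory.EllipticCurves.EisensteinNewformLevelRaising
import Literature.NumberTheory.EllipticCurves.LFunctionPrimeCoeff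
import Literature.NumberTheory.EllipticCurves.ModularityVersionApProofs
import Literature.NumberTheory.GaloisRepresentations.AbsolutelyIrreducibleReduction
import Literature.NumberTheory.EllipticCurves.NewformGaloisRepThm61OfNewformProofs
import Literature.NumberTheory.EllipticCurves.EisensteinNewformLevelRaisingInertiaProofs
import Literature.NumberTheory.GaloisRepresentations.StableLatticeValuationRing
import Literature.RepresentationTheory.Semisimple.FinTwoSemisimplification
import HarnessLib

/-!
# The LEVEL CLAUSE of K0₂@p: `max 2 (v_ℓ M) = max 2 (v_ℓ N_W)` at every `ℓ ≠ p` for every weight-2 `Γ₀(M)`-newform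
# congruent to `W` modulo `p` (REGISTERED stub `stub_levelMatch_ns` of `Lines/rtt_w3.lean`, assembly LM-H)

Route `SignedLowerHalves`, child L `SmallImageLowerHalfBothSigns` (item stmt-BirchSwinnertonDyer-23599), line `rtt_w3`
(skeleton of record v2 b8b0010d8543aede, 7 stubs; width seat `bsd-line-slh-p3-w3` gen 10; memo
`Lines/birth_acns-MEMO-w3-g10.md` §4).  THEOREMS ONLY (no definition, no new named fact, no `sorry`); ROUTE-INDEPENDENT.

`levelMatch`: granted Deligne's `p`-adic representation of a newform (named fact `Hida2000_thm326_exists_galoisRep`),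
Carayol's conductor theorem (named fact `Carayol1986_artinConductorExponent`) and Saito's half of Ogg's formula at the
additive places over `2` (`swanConductorAt_rationalTate_eq_wildConductorExponent_of_ringChar_eq_two`) — the three inputs
of the cite stub `stub_levelInputs_rtt` — for an elliptic `W/ℚ`, a prime `p`, a weight-`2` newform `g` on `Γ₀(M)`
(the stub's `p ∤ M` is not even needed) and an embedding `ι : K_g → ℚ̄_p` under which `a_ℓ(g) ≡ a_ℓ(W)` for every prime `ℓ ∤ p M N_W`:
`max 2 (v_ℓ M) = max 2 (v_ℓ N_W)` at every prime `ℓ ≠ p`.  Proof (all over `ℚ̄_p`):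
* `ρ_g` = Hida's irreducible representation attached to the `Γ₁(M)`-lift of `g` through an isomorphism `e : ℚ̄_p ≃ ℂ`
  extending `ι` (`exists_ringEquiv_padicAlgCl_complex_extends`); by Carayol `a_w(ρ_g) = v_ℓ(M)` at the place `w ∋ ℓ`;
* `ρ_W` = the framed `ℚ̄_p`-model of `V_p(W)` (brick LM-G): `a_w(ρ_W) = a_w(V_p W) = v_ℓ(N_W)` (Ogg–Saito);
* the Frobenius polynomials `X² - a_q X + q` of `ρ_g` and `ρ_W` at `q ∤ p M N_W` are congruent, so their residual
  representations are isomorphic (Chebotarev + Brauer–Nesbitt, `FramedGaloisRep.nonempty_equiv_of_isResidualRepOf_of_congruent`);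
* at every ramification group `Γ^u`, `u > 0`, over `ℓ`: elements act through `ℓ`-power order (brick LM-F), with
  determinant `1` (brick LM-E / LM-G), so both fixed spaces are `0` or everything (brick LM-B), and `Γ^u` acts trivially on
  `ρ_g` iff on `ρ_W` (brick LM-D: triviality is detected residually for `ℓ`-power-order elements);
* hence `max 2 a_w(ρ_g) = max 2 a_w(ρ_W)` (brick LM-C).
`stub_levelMatch_ns` is the registered stub, TYPE VERBATIM (its extra class hypotheses are not used).

BSD and crux L are NOT proved here; the two cite inputs remain hypotheses (they are the cite stub `stub_levelInputs_rtt`).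

References: H. Carayol, Ann. sci. ÉNS 19 (1986), Thm. (A); H. Darmon, F. Diamond, R. Taylor (1995) Thm. 3.1, Prop. 2.6;
J.-P. Serre, Duke 54 (1987) §3; N. Katz (1988) 1.8; J. Silverman ATAEC IV.10–11; T. Saito (1988).
-/

set_option autoImplicit false
set_option linter.dupNamespace false

noncomputable section

open scoped Classical NumberField MatrixGroups Polynomial
open IsDedekindDomain Field NumberField WeierstrassCurve CongruenceSubgroup Polynomial IsLocalRing Rat.HeightOneSpectrum
  Literature.NumberTheory.EllipticCurves Literature.NumberTheory.GaloisRepresentations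
  Literature.NumberTheory.EllipticCurves.Rank1Residual Summit.BirchSwinnertonDyer.Rank1Residual
  Literature.NumberTheory.EllipticCurves.ModularForms Literature.NumberTheory.Automorphic
  Literature.NumberTheory.EllipticCurves.GreenbergSelmer

namespace Summit.BirchSwinnertonDyer.BirchSwinnertonDyer.Theorems.SmallImageLambdaLowerThreeNsThetaPartner

/-! ### Small helpers -/

/-- For a framed representation, the `H`-fixed submodule of `A^n` is everything iff `ρ(σ) = 1` on `H`. [folklore] -/
theorem FramedRep.fixedSubmodule_toContinuousRep_eq_top_iff {G : Type*} [Group G] [TopologicalSpace G] {A : Type*}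
    [Field A] [TopologicalSpace A] [IsTopologicalRing A] {n : ℕ} (ρ : FramedRep G A n) (H : Subgroup G) :
    ρ.toContinuousRep.fixedSubmodule H = ⊤ ↔ ∀ σ ∈ H, ρ σ = 1 := by
  constructor
  · intro h σ hσ
    have hv : ∀ x : Fin n → A, ρ.toContinuousRep σ x = x := fun x =>
      (ρ.toContinuousRep.mem_fixedSubmodule H x).mp (by rw [h]; exact Submodule.mem_top) σ hσ
    have hM : ((ρ σ : GL (Fin n) A) : Matrix (Fin n) (Fin n) A) = 1 := by
      apply Matrix.toLin'.injective
      rw [Matrix.toLin'_one]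
      apply LinearMap.ext
      intro x
      rw [Matrix.toLin'_apply, LinearMap.id_apply]
      have := hv x
      rwa [FramedRep.toContinuousRep_apply_apply] at this
    exact Units.ext (by rw [hM, Units.val_one])
  · intro h
    refine ρ.toContinuousRep.fixedSubmodule_eq_top_of_forall_eq_one fun σ hσ => ?_
    rw [FramedRep.toContinuousRep_apply_eq_toLinAlgEquiv', h σ hσ, Units.val_one, map_one]

/-- An element of `ℚ̄_p` of norm `1` is a unit of `ℤ̄_p`. [folklore] -/
theorem padicAlgClIntegers.isUnit_of_norm_eq_one {p : ℕ} [Fact p.Prime] {x : PadicAlgCl p} (hx : ‖x‖ = 1) :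
    ∃ hx1 : x ∈ padicAlgClIntegers p, IsUnit (⟨x, hx1⟩ : padicAlgClIntegers p) := by
  have hx1 : x ∈ padicAlgClIntegers p := (padicAlgCl_mem_valuationSubring_iff p x).mpr hx.le
  refine ⟨hx1, ?_⟩
  by_contra hnu
  have hmem : (⟨x, hx1⟩ : padicAlgClIntegers p) ∈ maximalIdeal (padicAlgClIntegers p) :=
    (IsLocalRing.mem_maximalIdeal _).mpr (mem_nonunits_iff.mpr hnu)
  have hlt := (mem_maximalIdeal_iff_norm_lt_one (padicAlgCl_mem_valuationSubring_iff p) _).mp hmem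
  rw [hx] at hlt
  exact (lt_irrefl (1 : ℝ)) hlt

/-- `ℓ^k` is a unit of `ℤ̄_p` for a prime `ℓ ≠ p`. [folklore] -/
theorem padicAlgClIntegers.isUnit_natCast_prime_pow {p : ℕ} [Fact p.Prime] {ℓ : ℕ} (hℓ : ℓ.Prime) (hℓp : ℓ ≠ p)
    (k : ℕ) : IsUnit (((ℓ ^ k : ℕ) : ℕ) : padicAlgClIntegers p) := by
  obtain ⟨h1, hu⟩ := padicAlgClIntegers.isUnit_of_norm_eq_one (Hida2000Thm326.norm_natCast_padicAlgCl_eq_one hℓ hℓp)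
  have hcast : ((ℓ : ℕ) : padicAlgClIntegers p) = ⟨(ℓ : PadicAlgCl p), h1⟩ := Subtype.ext (by simp)
  rw [Nat.cast_pow, hcast]
  exact hu.pow k

/-- `‖z‖ ≤ 1` in `ℚ̄_p` for an integer `z`. [folklore] -/
theorem PadicAlgCl.norm_intCast_le_one' {p : ℕ} [Fact p.Prime] (z : ℤ) : ‖(z : PadicAlgCl p)‖ ≤ 1 := by
  rw [← map_intCast (algebraMap ℚ_[p] (PadicAlgCl p)), norm_algebraMap']
  exact Padic.norm_int_le_one z

/-! ### The level clause -/

/-- **The level clause of K0₂@p.**  See the module docstring.  Granted the named facts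
`Hida2000_thm326_exists_galoisRep` (Deligne) and `Carayol1986_artinConductorExponent` (Carayol) and Saito's half of
Ogg's formula at the additive places over `2`: for an elliptic `W/ℚ`, a prime `p`, a weight-`2` newform `g` on `Γ₀(M)`
and `ι : K_g → ℚ̄_p` with `|ι(a_ℓ(g)) - a_ℓ(W)|_p < 1` for all primes `ℓ ∤ p M N_W`, one has
`max 2 (v_ℓ M) = max 2 (v_ℓ N_W)` at every prime `ℓ ≠ p`.
[cite: CarayolASENS1986, Thm. (A) with (0.5), (0.8) Corollaire (pp. 410–411)]
[cite: DarmonDiamondTaylor1995, Thm. 3.1 (d), Prop. 2.6 and §2.1 (p. 54)] [cite: Katz1988, Ch. 1, 1.8 and Remark 1.10]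
[cite: SilvermanATAEC1994, Thm. IV.10.2 and IV.11.1] [cite: Saito1988, Theorem 1] -/
theorem levelMatch (hD : Hida2000_thm326_exists_galoisRep) (hC : Carayol1986_artinConductorExponent)
    (hS : ∀ (V : WeierstrassCurve ℚ) (ℓ : ℕ) [Fact ℓ.Prime],
      V.swanConductorAt_rationalTate_eq_wildConductorExponent_of_ringChar_eq_two ℓ)
    (W : WeierstrassCurve ℚ) [W.IsElliptic] [W.IsGloballyMinimal] (p : ℕ) [Fact p.Prime] {M : ℕ} [NeZero M]
    {g : CuspForm (Gamma0 M) 2} (ι : coeffField g →+* PadicAlgCl p) (hg : IsNewform0 g)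
    (hcong : ∀ ℓ : ℕ, ℓ.Prime → ¬ ℓ ∣ p * M * W.conductorNorm ℤ →
      ‖embCoeff g ι ℓ - (W.frobeniusTrace ℓ : PadicAlgCl p)‖ < 1)
    {ℓ : ℕ} (hℓ : ℓ.Prime) (hℓp : ℓ ≠ p) :
    max 2 (padicValNat ℓ M) = max 2 (padicValNat ℓ (W.conductorNorm ℤ)) := by
  classical
  have hp : p.Prime := Fact.out
  -- ### the `Γ₁(M)`-lift `g₁`, its coefficient field `K₁ ⊆ K_g`, and `e : ℚ̄_p ≃ ℂ` extending `ι` on `K₁`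
  have hg1 : IsNewform1 (liftToGamma1 M 2 g) := (isNewform1_liftToGamma1_iff_holds M 2 g).mpr hg
  have hg0 : g ≠ 0 := by
    intro h0
    have h1 : IsNormalized g := hg.2.2
    rw [IsNormalized, h0] at h1
    simp [UpperHalfPlane.qExpansion_zero] at h1
  haveI := numberField_coeffCharField_liftToGamma1 hg
  have hcoe : (⇑(liftToGamma1 M 2 g) : UpperHalfPlane → ℂ) = ⇑g := coe_liftToGamma1_holds M 2 g
  have hle : coeffCharField (liftToGamma1 M 2 g) ≤ coeffField g := coeffCharField_liftToGamma1_le hg0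
  set j : coeffCharField (liftToGamma1 M 2 g) →+* PadicAlgCl p := ι.comp (IntermediateField.inclusion hle).toRingHom
    with hj
  have hjn : ∀ n : ℕ, j ⟨(UpperHalfPlane.qExpansion 1 ⇑(liftToGamma1 M 2 g)).coeff n,
      cuspCoeff_mem_coeffCharField (liftToGamma1 M 2 g) n⟩ = embCoeff g ι n := by
    intro n
    have hval : (((IntermediateField.inclusion hle)
        ⟨(UpperHalfPlane.qExpansion 1 ⇑(liftToGamma1 M 2 g)).coeff n,
          cuspCoeff_mem_coeffCharField (liftToGamma1 M 2 g) n⟩ : coeffField g) : ℂ) =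
        (UpperHalfPlane.qExpansion 1 ⇑g).coeff n := by
      rw [IntermediateField.coe_inclusion]
      change (UpperHalfPlane.qExpansion 1 ⇑(liftToGamma1 M 2 g)).coeff n = (UpperHalfPlane.qExpansion 1 ⇑g).coeff n
      rw [hcoe]
    rw [hj, RingHom.comp_apply, embCoeff_def]
    exact congrArg ι (Subtype.ext hval)
  obtain ⟨e, he⟩ := DeligneSerre1974.exists_ringEquiv_padicAlgCl_complex_extends j (algebraMap (coeffCharField (liftToGamma1 M 2 g)) ℂ)
  have hje : (e.symm : ℂ →+* PadicAlgCl p).comp (algebraMap (coeffCharField (liftToGamma1 M 2 g)) ℂ) = j := by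
    ext x
    rw [RingHom.comp_apply, ← he x]
    exact e.symm_apply_apply (j x)
  -- ### `ρ_g` (Deligne, through `e`) and Carayol at the place `w ∋ ℓ`
  obtain ⟨ρg, hρg, hirr⟩ := hD (liftToGamma1 M 2 g) le_rfl hg1 p e
  set w : HeightOneSpectrum (𝓞 ℚ) := (primesEquiv (R := 𝓞 ℚ)).symm ⟨ℓ, hℓ⟩ with hw
  have hwℓ : ((primesEquiv w : Nat.Primes) : ℕ) = ℓ := by rw [hw, Equiv.apply_symm_apply]
  have hmemw : ∀ m : ℕ, (m : 𝓞 ℚ) ∈ w.asIdeal ↔ natGenerator w ∣ m := fun m => by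
    rw [natGenerator_dvd_iff, ← map_natCast (Rat.IsIntegralClosure.intEquiv (𝓞 ℚ)) m, Ideal.apply_mem_of_equiv_iff]
  have hℓw : (ℓ : 𝓞 ℚ) ∈ w.asIdeal := (hmemw ℓ).mpr (by rw [show natGenerator w = ℓ from hwℓ])
  have hpw : (p : 𝓞 ℚ) ∉ w.asIdeal := Rat.natCast_not_mem_of_ne hℓ hp hℓp w hℓw
  have hcar : ρg.toGaloisRep.artinConductorExponent w = padicValNat ℓ M :=
    hC (liftToGamma1 M 2 g) le_rfl hg1 p e ρg hρg hirr ℓ hℓ hℓp w hℓw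
  -- ### `ρ_W` and Ogg–Saito at `w`
  obtain ⟨ρW, hWfrob, hWcond, hWdet, -⟩ := exists_framedGaloisRep_padicAlgCl_tate W p
  have hWa : ρW.toGaloisRep.artinConductorExponent w = padicValNat ℓ (W.conductorNorm ℤ) := by
    rw [hWcond w hpw, padicValNat_conductorNorm_eq_conductorExponentOf W p (hS W p) hℓ hℓp w hℓw]
  rw [← hcar, ← hWa]
  -- ### the prime `𝔓 ∣ w` of `ℚ̄`, `ℓ ∈ 𝔓`, `‖ℓ‖ = 1` in `ℚ̄_p`
  have h𝔓 := (HeightOneSpectrum.primesAbove_nonempty w).some_mem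
  haveI : (HeightOneSpectrum.primesAbove_nonempty w).some.IsMaximal := HeightOneSpectrum.isMaximal_of_mem_primesAbove h𝔓
  have hℓ𝔓 : ((ℓ : ℕ) : absIntegers (𝓞 ℚ) ℚ) ∈ (HeightOneSpectrum.primesAbove_nonempty w).some := by
    have h3 : ((ℓ : ℕ) : absIntegers (𝓞 ℚ) ℚ) = algebraMap (𝓞 ℚ) (absIntegers (𝓞 ℚ) ℚ) ℓ := (map_natCast _ _).symm
    have h4 : ((ℓ : ℕ) : 𝓞 ℚ) ∈ (HeightOneSpectrum.primesAbove_nonempty w).some.under (𝓞 ℚ) := by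
      rw [← h𝔓.2.over]; exact hℓw
    rw [h3]; exact h4
  have hℓnorm : ‖(ℓ : PadicAlgCl p)‖ = 1 := Hida2000Thm326.norm_natCast_padicAlgCl_eq_one hℓ hℓp
  -- ### congruent Frobenius polynomials off `S = {q ∣ p M N_W}` ⟹ isomorphic residual representations
  have hO : ∀ x : PadicAlgCl p, x ∈ padicAlgClIntegers p ↔ ‖x‖ ≤ 1 := padicAlgCl_mem_valuationSubring_iff p
  have hOm : ∀ x : padicAlgClIntegers p, x ∈ maximalIdeal (padicAlgClIntegers p) ↔ ‖(x : PadicAlgCl p)‖ < 1 :=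
    mem_maximalIdeal_iff_norm_lt_one hO
  set S : Set (HeightOneSpectrum (𝓞 ℚ)) := {v | ((primesEquiv v : Nat.Primes) : ℕ) ∣ p * M * W.conductorNorm ℤ}
    with hSdef
  have hS0 : p * M * W.conductorNorm ℤ ≠ 0 :=
    mul_ne_zero (mul_ne_zero hp.ne_zero (NeZero.ne M)) (W.conductorNorm_pos_holds).ne'
  have hSfin : S.Finite := DeligneSerre1974.finite_setOf_primesEquiv_dvd hS0
  have hε : nebentypus (liftToGamma1 M 2 g) = 1 := nebentypus_liftToGamma1_holds M 2 hg0
  have hdata : ∀ v ∉ S, ρg.IsUnramifiedAt v ∧ ρW.IsUnramifiedAt v ∧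
      ∃ P P' : Polynomial (padicAlgClIntegers p),
        ρg.HasFrobCharpolyAt v (P.map (padicAlgClIntegers p).subtype) ∧
        ρW.HasFrobCharpolyAt v (P'.map (padicAlgClIntegers p).subtype) ∧
        P.map (residue (padicAlgClIntegers p)) = P'.map (residue (padicAlgClIntegers p)) := by
    intro v hv
    set q : ℕ := ((primesEquiv v : Nat.Primes) : ℕ) with hqdef
    have hq : q.Prime := (primesEquiv v).2
    haveI := Fact.mk hq
    have hvS : ¬ q ∣ p * M * W.conductorNorm ℤ := hv
    have hqMp : q ∉ {q | q ∣ M * p} := fun h => hvS (by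
      rw [mul_comm p M]; exact dvd_mul_of_dvd_left h _)
    have hqN : ¬ q ∣ W.conductorNorm ℤ := fun h => hvS (dvd_mul_of_dvd_right h _)
    have hqp : q ≠ p := fun h => hvS (by rw [h]; exact dvd_mul_of_dvd_left (dvd_mul_right p M) _)
    have hqM : q.Coprime M := (Nat.Prime.coprime_iff_not_dvd hq).mpr fun h =>
      hvS (dvd_mul_of_dvd_left (dvd_mul_of_dvd_right h p) _)
    have hqv : (q : 𝓞 ℚ) ∈ v.asIdeal := by
      have hmemv : (q : 𝓞 ℚ) ∈ v.asIdeal ↔ natGenerator v ∣ q := by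
        rw [natGenerator_dvd_iff, ← map_natCast (Rat.IsIntegralClosure.intEquiv (𝓞 ℚ)) q, Ideal.apply_mem_of_equiv_iff]
      exact hmemv.mpr dvd_rfl
    have hpv : (p : 𝓞 ℚ) ∉ v.asIdeal := Rat.natCast_not_mem_of_ne hq hp hqp v hqv
    have hgood : W.HasGoodReductionAt v := by
      by_contra hbad
      exact hqN ((W.dvd_conductorNorm_iff v).mpr hbad)
    have hgoodq : W.HasGoodReductionAtPrime q :=
      (W.hasGoodReductionAtPrime_iff_hasGoodReductionAt_ringOfIntegers v).mpr hgood
    -- `ρ_g` at `v`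
    obtain ⟨hgu, hgchar⟩ := hρg v hqMp
    rw [hje, map_heckePolynomial_of_nebentypus_eq_one hε (by norm_num) hqM j, hjn q] at hgchar
    have h21 : ((2 : ℤ) - 1).toNat = 1 := by norm_num
    rw [h21, pow_one] at hgchar
    -- `ρ_W` at `v`
    obtain ⟨hWu, hWchar⟩ := hWfrob v hpv hgood
    rw [W.LFunction_apply_prime_eq_frobeniusTrace q hgoodq] at hWchar
    -- the integral polynomials
    have hcq := hcong q hq hvS
    have ht : ‖((W.frobeniusTrace q : ℤ) : PadicAlgCl p)‖ ≤ 1 := PadicAlgCl.norm_intCast_le_one' _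
    have ha : ‖embCoeff g ι q‖ ≤ 1 := by
      have : embCoeff g ι q = (embCoeff g ι q - (W.frobeniusTrace q : PadicAlgCl p)) +
          (W.frobeniusTrace q : PadicAlgCl p) := by ring
      rw [this]
      exact (PadicAlgCl.isNonarchimedean p _ _).trans (max_le hcq.le ht)
    let a : padicAlgClIntegers p := ⟨embCoeff g ι q, (hO _).mpr ha⟩
    let t : padicAlgClIntegers p := ⟨((W.frobeniusTrace q : ℤ) : PadicAlgCl p), (hO _).mpr ht⟩
    refine ⟨hgu, hWu, X ^ 2 - C a * X + C (q : padicAlgClIntegers p), X ^ 2 - C t * X + C (q : padicAlgClIntegers p),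
      ?_, ?_, ?_⟩
    · have hP : (X ^ 2 - C a * X + C (q : padicAlgClIntegers p) : Polynomial (padicAlgClIntegers p)).map
          (padicAlgClIntegers p).subtype = X ^ 2 - C (embCoeff g ι q) * X + C (q : PadicAlgCl p) := by
        simp only [Polynomial.map_add, Polynomial.map_sub, Polynomial.map_mul, Polynomial.map_pow, Polynomial.map_X,
          Polynomial.map_C, map_natCast (padicAlgClIntegers p).subtype q]
        rfl
      rw [hP]
      exact hgchar
    · have hP' : (X ^ 2 - C t * X + C (q : padicAlgClIntegers p) : Polynomial (padicAlgClIntegers p)).map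
          (padicAlgClIntegers p).subtype =
          X ^ 2 - C ((W.frobeniusTrace q : ℤ) : PadicAlgCl p) * X + C ((q : ℕ) : PadicAlgCl p) := by
        simp only [Polynomial.map_add, Polynomial.map_sub, Polynomial.map_mul, Polynomial.map_pow, Polynomial.map_X,
          Polynomial.map_C, map_natCast (padicAlgClIntegers p).subtype q]
        rfl
      rw [hP']
      exact hWchar
    · have hat : residue (padicAlgClIntegers p) a = residue (padicAlgClIntegers p) t := by
        rw [← sub_eq_zero, ← map_sub, IsLocalRing.residue_eq_zero_iff, hOm]
        exact hcq
      simp only [Polynomial.map_add, Polynomial.map_sub, Polynomial.map_mul, Polynomial.map_pow, map_X, map_C, hat]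
  -- residual representations of `ρ_g`, `ρ_W` (integral models over the open valuation ring `ℤ̄_p`, reduction,
  -- rank-two semisimplification — as in the tree's `FramedGaloisRep.exists_isResidualRepOf_fin_two`)
  have hres : ∀ ρ : FramedGaloisRep ℚ (PadicAlgCl p) 2, ∃ τ, ρ.IsResidualRepOf (RingHom.id _) τ := by
    intro ρ
    have hOopen : IsOpen ((padicAlgClIntegers p : ValuationSubring (PadicAlgCl p)) : Set (PadicAlgCl p)) :=
      Valued.isOpen_valuationSubring _
    obtain ⟨P, ρ₀, hρ₀⟩ := exists_integralModel_of_valuationSubring (O := padicAlgClIntegers p) hOopen ρ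
    obtain ⟨τ, hss, hcp, hker⟩ := Literature.RepresentationTheory.Semisimple.exists_semisimplification_fin_two (integralReduction (RingHom.id _) ρ₀)
    exact ⟨τ, integralReduction (RingHom.id _) ρ₀, ⟨ρ₀, 1, ⟨P, hρ₀⟩, fun g => by simp⟩, hss, hcp, hker⟩
  obtain ⟨τg, hτg⟩ := hres ρg
  obtain ⟨τW, hτW⟩ := hres ρW
  obtain ⟨eqv⟩ := FramedGaloisRep.nonempty_equiv_of_isResidualRepOf_of_congruent ρg ρW hSfin hdata hτg hτW
  -- ### torsion, determinants and triviality on the ramification groups `Γ^u`, `u > 0`, at `𝔓`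
  have htors : ∀ (ρ : FramedGaloisRep ℚ (PadicAlgCl p) 2) {u : ℝ}, 0 < u →
      ∀ σ ∈ absUpperRamificationSubgroup (𝓞 ℚ) (HeightOneSpectrum.primesAbove_nonempty w).some u,
        ∃ k : ℕ, ρ σ ^ (ℓ ^ k) = 1 := fun ρ u hu σ hσ =>
    FramedGaloisRep.exists_pow_prime_pow_eq_one_of_mem_absUpperRamificationSubgroup ρ _ hℓ𝔓 hℓnorm hu hσ
  have hpow : ∀ (ρ : FramedGaloisRep ℚ (PadicAlgCl p) 2) {u : ℝ}, 0 < u →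
      ∀ σ ∈ absUpperRamificationSubgroup (𝓞 ℚ) (HeightOneSpectrum.primesAbove_nonempty w).some u,
        ∃ N : ℕ, (N : PadicAlgCl p) ≠ 0 ∧ ρ σ ^ N = 1 := by
    intro ρ u hu σ hσ
    obtain ⟨k, hk⟩ := htors ρ hu σ hσ
    exact ⟨ℓ ^ k, by exact_mod_cast pow_ne_zero k hℓ.ne_zero, hk⟩
  have hIner : ∀ u : ℝ, absUpperRamificationSubgroup (𝓞 ℚ) (HeightOneSpectrum.primesAbove_nonempty w).some u ≤
      (HeightOneSpectrum.primesAbove_nonempty w).some.inertia (absoluteGaloisGroup ℚ) := fun u =>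
    absUpperRamificationSubgroup_le_inertia_holds (𝓞 ℚ) _ u
  have hpw' : ((p : ℕ) : 𝓞 ℚ) ∉ w.asIdeal := hpw
  refine GaloisRep.max_two_artinConductorExponent_eq w ρg.toGaloisRep ρW.toGaloisRep (by simp) (by simp)
    (fun u hu => ?_) (fun u hu => ?_) (fun u hu => ?_)
  · exact FramedRep.fixedSubmodule_eq_bot_or_eq_top_of_forall_exists_pow ρg _ (hpow ρg hu)
      fun σ hσ => det_eq_one_of_mem_inertia_of_isGaloisRepOfNewform1_liftToGamma1 hg0 hρg hpw' h𝔓 (hIner u hσ)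
  · exact FramedRep.fixedSubmodule_eq_bot_or_eq_top_of_forall_exists_pow ρW _ (hpow ρW hu)
      fun σ hσ => hWdet w hpw _ h𝔓 σ (hIner u hσ)
  · change ρg.toContinuousRep.fixedSubmodule _ = ⊤ ↔ ρW.toContinuousRep.fixedSubmodule _ = ⊤
    rw [FramedRep.fixedSubmodule_toContinuousRep_eq_top_iff, FramedRep.fixedSubmodule_toContinuousRep_eq_top_iff]
    refine forall₂_congr fun σ hσ => ?_
    obtain ⟨k, hk⟩ := htors ρg hu σ hσ
    obtain ⟨k', hk'⟩ := htors ρW hu σ hσ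
    have hK : ρg σ ^ (ℓ ^ (k + k')) = 1 := by rw [pow_add, pow_mul, hk, one_pow]
    have hK' : ρW σ ^ (ℓ ^ (k + k')) = 1 := by rw [Nat.add_comm, pow_add, pow_mul, hk', one_pow]
    exact FramedGaloisRep.apply_eq_one_iff_of_isResidualRepOf_equiv ρg ρW hτg hτW eqv
      (padicAlgClIntegers.isUnit_natCast_prime_pow hℓ hℓp (k + k')) hK hK'

/-- **The REGISTERED stub `stub_levelMatch_ns` of `Lines/rtt_w3.lean` (v2, skeleton of record of item
stmt-BirchSwinnertonDyer-23599 since 2026-08-29T19:01:30Z), TYPE VERBATIM, proved** — by `levelMatch` (the class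
hypotheses `p ≠ 2`, `ClassX7`, non-CM, `a_p = 0`, `¬ Surj`, and `IsCMForm` are not used).  The three antecedents are
the cite stub `stub_levelInputs_rtt` (Deligne/Hida, Carayol, Saito); nothing else is assumed; no `sorry`.
[cite: CarayolASENS1986, Thm. (A) with (0.5), (0.8) Corollaire (pp. 410–411)]
[cite: DarmonDiamondTaylor1995, Thm. 3.1 (d), Prop. 2.6 and §2.1 (p. 54)] -/
theorem stub_levelMatch_ns : Hida2000_thm326_exists_galoisRep → Carayol1986_artinConductorExponent →
    (∀ (V : WeierstrassCurve ℚ) (ℓ : ℕ) [Fact ℓ.Prime],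
      V.swanConductorAt_rationalTate_eq_wildConductorExponent_of_ringChar_eq_two ℓ) →
    ∀ (W : WeierstrassCurve ℚ) [W.IsElliptic] [W.IsGloballyMinimal] (p : ℕ) [Fact p.Prime],
      p ≠ 2 → ClassX7 W p → ¬ W.HasCM → W.frobeniusTrace p = 0 → ¬ Surj W p →
      ∀ (M : ℕ) [NeZero M] (g : CuspForm (Gamma0 M) 2) (ι : coeffField g →+* PadicAlgCl p),
        ¬ p ∣ M → IsNewform0 g → Literature.NumberTheory.Automorphic.IsCMForm (liftToGamma1 M 2 g) →
        (∀ ℓ : ℕ, ℓ.Prime → ¬ ℓ ∣ p * M * W.conductorNorm ℤ →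
          ‖embCoeff g ι ℓ - (W.frobeniusTrace ℓ : PadicAlgCl p)‖ < 1) →
        ∀ ℓ : ℕ, ℓ.Prime → ℓ ≠ p → max 2 (padicValNat ℓ M) = max 2 (padicValNat ℓ (W.conductorNorm ℤ)) := by
  intro hD hC hS W _ _ p _ _ _ _ _ _ M _ g ι _ hg _ hcong ℓ hℓ hℓp
  exact levelMatch hD hC hS W p ι hg hcong hℓ hℓp


/-- **K0₂@p WITH its level clause (v1 text of `stub_heckeThetaPartner_ns`), for citation**: granted the cite stub's
three named inputs (Deligne/Hida, Carayol, Saito@2), every small-image X7 pair `(W, p)` (odd `p`) has a LEVEL-MATCHED Hecke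
theta partner `(M, g, ι, Ω)` — `stub_heckeThetaPartner_ns` (landed, unconditional) with the level clause supplied by
`levelMatch`; moreover every prime of `M` is bad for `W`.  This is the object stubs Kan₂/Kλ₂ of `Lines/rtt_w3.lean` consume.
[cite: Serre1972, §4.2 c), §5.2 (iv)] [cite: Ribet1977Nebentypus, §3 Thm. 3.6]
[cite: CarayolASENS1986, Thm. (A) with (0.5), (0.8) Corollaire (pp. 410–411)] -/
theorem heckeThetaPartner_levelMatched (hD : Hida2000_thm326_exists_galoisRep)
    (hC : Carayol1986_artinConductorExponent)
    (hS : ∀ (V : WeierstrassCurve ℚ) (ℓ : ℕ) [Fact ℓ.Prime],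
      V.swanConductorAt_rationalTate_eq_wildConductorExponent_of_ringChar_eq_two ℓ)
    (W : WeierstrassCurve ℚ) [W.IsElliptic] [W.IsGloballyMinimal] (p : ℕ) [Fact p.Prime] (hp2 : p ≠ 2)
    (hX : ClassX7 W p) (hs : ¬ Surj W p) :
    ∃ (M : ℕ) (_ : NeZero M) (g : CuspForm (Gamma0 M) 2) (ι : coeffField g →+* PadicAlgCl p) (Ω : ℂ),
      ¬ p ∣ M ∧ (∀ ℓ : ℕ, ∀ [Fact ℓ.Prime], ℓ ∣ M → ¬ W.HasGoodReductionAtPrime ℓ) ∧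
        (∀ ℓ : ℕ, ℓ.Prime → ℓ ≠ p → max 2 (padicValNat ℓ M) = max 2 (padicValNat ℓ (W.conductorNorm ℤ))) ∧
        IsNewform0 g ∧ Literature.NumberTheory.Automorphic.IsCMForm (liftToGamma1 M 2 g) ∧
        cuspCoeff g p = 0 ∧ IsCohomologicalPlusPeriod g ι Ω ∧
        (∀ ℓ : ℕ, ℓ.Prime → ¬ ℓ ∣ p * M * W.conductorNorm ℤ →
          ‖embCoeff g ι ℓ - (W.frobeniusTrace ℓ : PadicAlgCl p)‖ < 1) := by
  obtain ⟨M, hM, g, ι, Ω, hpM, hbad, hnew, hcmf, hapg, hΩ, hcong⟩ := heckeThetaPartner_sansLevel W p hp2 hX hs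
  haveI := hM
  exact ⟨M, hM, g, ι, Ω, hpM, hbad, fun ℓ hℓ hℓp => levelMatch hD hC hS W p ι hnew hcong hℓ hℓp, hnew, hcmf, hapg, hΩ,
    hcong⟩

end Summit.BirchSwinnertonDyer.BirchSwinnertonDyer.Theorems.SmallImageLambdaLowerThreeNsThetaPartner

end
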